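import Literature.Combinatorics.Optimization.RosenbergQuadratization
import Mathlib.Algebra.Order.BigOperators.Group.Finset

/-!
# E42-quadpenalty receipt: minimising a Rosenberg-quadratized objective over its auxiliary variables

HONEST FRAMING: instance-level adjudication of specific advantage claims; no claim about BQP vs BPP or
the summit.

Certificate `certs/E42-quadpenalty` of the pub-qadeq cell (unit pub-qadeq-harvest-2, gen 21) decides, for
the public DQOF instances of Kim et al. arXiv:2604.20599 (CLAIMS E-42), whether the quadratized QUBO handed
to the classical baselines has the same minimum as the cubic HUBO.  All three of its implementations rest
on one identity (README (i)): at a fixed assignment `x` of the original variables the auxiliary variables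
decouple, and for the pair `p = (a, b)` carrying the cubic terms `Σ_t v_t x_a x_b x_{r(t)} = A_p(x)·x_a x_b`,
replaced by `A_p(x)·z_p + M·P(x_a, x_b, z_p)` with Rosenberg's penalty `P` (tree:
`Literature.Combinatorics.Optimization.Rosenberg.penalty`, [BorosGruber2014, §2.1]),

  `min_{z_p ∈ 𝔹} (A_p z_p + M P(x_a, x_b, z_p)) = A_p·x_a x_b + min(0, g_p)`,
  `g_p = M − A_p` if `x_a = x_b = 1`, `A_p + M` if exactly one of `x_a, x_b` is `1`, `A_p + 3M` if both are `0`,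

so that `min_z QUBO_M(x, z) = H(x) + Σ_p min(0, g_p(x))`.  This file proves exactly that: the per-pair
identity (`pairMin_eq`), the separable minimisation over a finite family of binary auxiliaries
(`sum_min_le`, `exists_sum_eq_sum_min`), and the assembled statement (`quboMin_eq`): for every `z`,
`QUBO(x, z) ≥ H(x) + Σ_p min(0, g_p)`, with equality for some `z`.  Pure finite arithmetic over a linear
ordered commutative ring; nothing here refers to any solver, instance file or running time.
-/

namespace Summit.QuantumAdvantage.Dequantization

namespace QuadratizedPairMinimum

open Finset Literature.Combinatorics.Optimization.Rosenberg

variable {R : Type*} [CommRing R] [LinearOrder R] [IsStrictOrderedRing R]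

/-- The case quantity `g_p` of certs/E42-quadpenalty README (i): `M − A` if `x_a = x_b = 1`, `A + M` if exactly
one of them is `1`, `A + 3M` if both are `0`. -/
def gap (A M : R) (xa xb : Bool) : R :=
  if xa && xb then M - A else if xa || xb then A + M else A + 3 * M

/-- The contribution of one substituted pair to the quadratized objective, as a function of its auxiliary
`w`: `A·w + M·P(x_a, x_b, w)`. -/
def pairTerm (A M : R) (xa xb w : Bool) : R :=
  A * bit w + M * penalty xa xb w

/-- `min u v = v + min 0 (u − v)`. -/
private theorem min_eq_add_min_sub (u v : R) : min u v = v + min 0 (u - v) := by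
  rcases le_total u v with h | h
  · rw [min_eq_left h, min_eq_right (sub_nonpos.mpr h)]; ring
  · rw [min_eq_right h, min_eq_left (sub_nonneg.mpr h)]; ring

/-- **Per-pair identity.** `min_{w ∈ 𝔹} (A w + M P(x_a, x_b, w)) = A·x_a x_b + min(0, g)`. -/
theorem pairMin_eq (A M : R) (xa xb : Bool) :
    min (pairTerm A M xa xb false) (pairTerm A M xa xb true) = A * bit (xa && xb) + min 0 (gap A M xa xb) := by
  cases xa <;> cases xb
  · -- both 0: min(0, A + 3M)
    have h1 : pairTerm A M false false false = 0 := by simp [pairTerm, penalty_eq]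
    have h2 : pairTerm A M false false true = A + 3 * M := by simp [pairTerm, penalty_eq]; ring
    rw [h1, h2]; simp [gap]
  · -- xa = 0, xb = 1: min(0, A + M)
    have h1 : pairTerm A M false true false = 0 := by simp [pairTerm, penalty_eq]
    have h2 : pairTerm A M false true true = A + M := by simp [pairTerm, penalty_eq]
    rw [h1, h2]; simp [gap]
  · -- xa = 1, xb = 0
    have h1 : pairTerm A M true false false = 0 := by simp [pairTerm, penalty_eq]
    have h2 : pairTerm A M true false true = A + M := by simp [pairTerm, penalty_eq]
    rw [h1, h2]; simp [gap]
  · -- both 1: min(M, A) = A + min(0, M − A)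
    have h1 : pairTerm A M true true false = M := by simp [pairTerm, penalty_eq]
    have h2 : pairTerm A M true true true = A := by simp [pairTerm, penalty_eq]
    rw [h1, h2]; simp only [gap, Bool.and_self, if_true, bit_true, mul_one]
    exact min_eq_add_min_sub M A

/-- The value at the consistent auxiliary `w = x_a ∧ x_b` is `A·x_a x_b` (penalty zero). -/
theorem pairTerm_consistent (A M : R) (xa xb : Bool) :
    pairTerm A M xa xb (xa && xb) = A * bit (xa && xb) := by
  simp [pairTerm, (penalty_eq_zero_iff xa xb (xa && xb)).mpr rfl]

section Separable

variable {P : Type*} [Fintype P]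

/-- Separable minimisation, lower bound: for every choice of the auxiliaries,
`Σ_p f_p(z_p) ≥ Σ_p min(f_p(0), f_p(1))`. -/
theorem sum_min_le (f : P → Bool → R) (z : P → Bool) :
    (∑ p, min (f p false) (f p true)) ≤ ∑ p, f p (z p) :=
  Finset.sum_le_sum fun p _ => by cases z p <;> simp

omit [IsStrictOrderedRing R] in
/-- Separable minimisation, attainment: some choice of the auxiliaries attains `Σ_p min(f_p(0), f_p(1))`. -/
theorem exists_sum_eq_sum_min (f : P → Bool → R) :
    ∃ z : P → Bool, (∑ p, f p (z p)) = ∑ p, min (f p false) (f p true) := by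
  refine ⟨fun p => decide (f p true < f p false), Finset.sum_congr rfl fun p _ => ?_⟩
  by_cases h : f p true < f p false
  · simp [h, min_eq_right h.le]
  · simp [h, min_eq_left (not_lt.mp h)]

end Separable

section Assembled

variable {P : Type*} [Fintype P]

/-- The quadratized objective at fixed original variables: `H` is the HUBO value `H(x)` (which contains the
cubic part `Σ_p A_p·x_a x_b`), and each pair's cubic part is replaced by `A_p z_p + M P(x_a, x_b, z_p)`. -/
def qubo (H M : R) (A : P → R) (xa xb : P → Bool) (z : P → Bool) : R :=
  H - (∑ p, A p * bit (xa p && xb p)) + ∑ p, pairTerm (A p) M (xa p) (xb p) (z p)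

/-- At the consistent auxiliaries the quadratized objective equals the HUBO value. -/
theorem qubo_consistent (H M : R) (A : P → R) (xa xb : P → Bool) :
    qubo H M A xa xb (fun p => xa p && xb p) = H := by
  simp [qubo, pairTerm_consistent]

/-- **`min_z QUBO_M(x, z) = H(x) + Σ_p min(0, g_p(x))`** (certs/E42-quadpenalty README (i)): the right-hand
side is a lower bound for every auxiliary assignment and is attained. -/
theorem quboMin_eq (H M : R) (A : P → R) (xa xb : P → Bool) :
    (∀ z, H + ∑ p, min 0 (gap (A p) M (xa p) (xb p)) ≤ qubo H M A xa xb z) ∧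
      ∃ z, qubo H M A xa xb z = H + ∑ p, min 0 (gap (A p) M (xa p) (xb p)) := by
  have key : (∑ p, min (pairTerm (A p) M (xa p) (xb p) false) (pairTerm (A p) M (xa p) (xb p) true)) =
      (∑ p, A p * bit (xa p && xb p)) + ∑ p, min 0 (gap (A p) M (xa p) (xb p)) := by
    rw [← Finset.sum_add_distrib]
    exact Finset.sum_congr rfl fun p _ => pairMin_eq _ _ _ _
  constructor
  · intro z
    have h := sum_min_le (fun p => pairTerm (A p) M (xa p) (xb p)) z
    simp only [qubo]
    rw [key] at h
    linarith
  · obtain ⟨z, hz⟩ := exists_sum_eq_sum_min (fun p => pairTerm (A p) M (xa p) (xb p))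
    refine ⟨z, ?_⟩
    simp only [qubo]
    rw [hz, key]
    ring

/-- Consequently the quadratization is an exact reformulation at `x` (no auxiliary assignment goes below
`H(x)`) iff every `g_p(x) ≥ 0`; in particular whenever `M ≥ max_p |A_p(x)|`-type conditions make all
`g_p ≥ 0`.  Stated as: all `g_p ≥ 0` implies `QUBO(x, z) ≥ H(x)` for all `z`. -/
theorem le_qubo_of_gap_nonneg (H M : R) (A : P → R) (xa xb : P → Bool)
    (hg : ∀ p, 0 ≤ gap (A p) M (xa p) (xb p)) (z : P → Bool) : H ≤ qubo H M A xa xb z := by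
  have h := (quboMin_eq H M A xa xb).1 z
  have hs : (∑ p, min 0 (gap (A p) M (xa p) (xb p))) = 0 :=
    Finset.sum_eq_zero fun p _ => min_eq_left (hg p)
  linarith

/-- If `|A_p| < M` then `g_p > 0` in all four cases (the per-pair form of the printed sufficient condition). -/
theorem gap_pos_of_abs_lt {A M : R} (h : |A| < M) (xa xb : Bool) : 0 < gap A M xa xb := by
  have h1 := (abs_lt.mp h).1
  have h2 := (abs_lt.mp h).2
  have hM : 0 < M := lt_of_le_of_lt (abs_nonneg A) h
  cases xa <;> cases xb <;> simp [gap] <;> linarith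

end Assembled

end QuadratizedPairMinimum

end Summit.QuantumAdvantage.Dequantization
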